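import Summits.QuantumFields.QCD.Theorems.QuarksAsStableActionSmallHoppingDiamagnetismDeficit
import Literature.MathematicalPhysics.QuantumLattice.GrassmannIntegralProofs

/-!
# Small-hopping diamagnetism (stmt-QuantumFields-9738): short closed words and their spin traces

Combinatorics of the words of the hopping expansion and the algebra of their Wilson spin factors
`spinMat l = 1 ∓ γ_μ` (chiral-basis `euclideanGamma`), `spinWord w = Π spinMat`:

* `disp_apply`, `balanced_of_disp_eq_zero` : a word of length `< L` which is closed on the torus
  of side `L` is balanced (closed in `ℤ⁴`) — winding words have length `≥ L`;
* `even_length_of_balanced`, `eq_inv_of_balanced_two`, `balanced_four` : balanced words have even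
  length, those of length two are backtracks `[a, a⁻¹]`, and those of length four either contain
  two consecutive mutually inverse letters or are plaquette words `[a, b, a⁻¹, b⁻¹]` with `a`, `b`
  in different directions (finite check by `decide`);
* `hol_plaquetteWord` : the canonical plaquette word `[+μ̂, +ν̂, -μ̂, -ν̂]` has holonomy
  `plaquetteHolonomy V x μ ν`; `card_words` : there are `8ᵏ` words of length `k`;
* `spinMat_mul_spinMat_inv` : `(1 ∓ γ_μ)(1 ± γ_μ) = 0` — backtracking words drop out;
* `trace_spinWord_im` : `tr (spinWord w)` is real (complex conjugation of the gamma matrices is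
  conjugation by the real matrix `K = γ₀ γ₂`);
* `norm_trace_spinWord_le` : `‖tr (spinWord w)‖ ≤ 4 · 2^{|w|}` (row sums of `1 ∓ γ_μ` are `≤ 2`);
* `trace_spinWord_plaquette` : `tr [(1-A)(1-B)(1+A)(1+B)] = -8` for anticommuting traceless
  involutions, whence `tr (spinWord [a, b, a⁻¹, b⁻¹]) = -8` for letters in different directions and
  `Re tr (spinWord w) ≤ 0` for every balanced word of length four (`re_trace_spinWord_four_le`).
-/

noncomputable section

namespace Summit.QuantumFields.QCD.Theorems.SmallHopping

section Words

open Literature.Probability.LatticeModels Literature.MathematicalPhysics.QuantumLattice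
  Literature.MathematicalPhysics.QuantumFieldTheory

variable {L : ℕ} {G : Type*} [Group G]

/-! ## Displacements and letter counts -/

/-- The `μ`-th coordinate of the displacement of a word: `#(+μ̂) - #(-μ̂)` modulo `L`. -/
theorem disp_apply (w : List Letter) (μ : Fin 4) :
    (disp w : TorusSite 4 L) μ = (w.count (μ, true) : ZMod L) - (w.count (μ, false) : ZMod L) := by
  induction w with
  | nil => simp
  | cons l w ih =>
    rw [disp_cons, Pi.add_apply, ih, List.count_cons, List.count_cons]
    obtain ⟨ν, b⟩ := l
    by_cases hνμ : ν = μ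
    · subst hνμ
      cases b <;> simp [stepVec] <;> ring
    · have h1 : ((ν, true) == (μ, true)) = false := by simpa using hνμ
      have h2 : ((ν, false) == (μ, false)) = false := by simpa using hνμ
      cases b <;> simp [stepVec, Ne.symm hνμ, hνμ]

/-- **Short closed words are balanced**: a word of length `< L` closed on the torus of side `L`
has as many `+μ̂` as `-μ̂` steps in every direction (a winding word needs at least `L` steps). -/
theorem balanced_of_disp_eq_zero [NeZero L] (w : List Letter) (hw : w.length < L)
    (hd : disp w = (0 : TorusSite 4 L)) : balanced w = true := by
  rw [balanced_iff]
  have key : ∀ μ : Fin 4, w.count (μ, true) = w.count (μ, false) := by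
    intro μ
    have h := congrFun hd μ
    rw [disp_apply, Pi.zero_apply, sub_eq_zero, ← Int.cast_natCast (R := ZMod L),
      ← Int.cast_natCast (R := ZMod L) (w.count (μ, false)),
      ZMod.intCast_eq_intCast_iff_dvd_sub] at h
    have h1 : (w.count (μ, true) : ℤ) ≤ w.length := by exact_mod_cast List.count_le_length
    have h2 : (w.count (μ, false) : ℤ) ≤ w.length := by exact_mod_cast List.count_le_length
    have h3 : (w.length : ℤ) < L := by exact_mod_cast hw
    have h4 : |((w.count (μ, false) : ℕ) : ℤ) - ((w.count (μ, true) : ℕ) : ℤ)| < (L : ℤ) := by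
      rw [abs_lt]; constructor <;> linarith [Int.natCast_nonneg (w.count (μ, true)),
        Int.natCast_nonneg (w.count (μ, false))]
    have h5 := Int.eq_zero_of_abs_lt_dvd h h4
    omega
  rintro ⟨μ, b⟩
  cases b
  · simpa [Letter.inv] using (key μ).symm
  · simpa [Letter.inv] using key μ

/-! ## Balanced words of small length -/

/-- Balanced words have even length. -/
theorem even_length_of_balanced (n : ℕ) :
    ∀ w : List Letter, w.length ≤ n → balanced w = true → Even w.length := by
  induction n with
  | zero =>
    intro w hw _
    rw [Nat.le_zero, List.length_eq_zero_iff] at hw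
    subst hw
    simp
  | succ n ih =>
    intro w hw hbal
    cases w with
    | nil => simp
    | cons l u =>
      obtain ⟨u₁, u₂, rfl⟩ := List.append_of_mem (inv_mem_of_balanced_cons hbal)
      have hlen : (u₁ ++ u₂).length ≤ n := by
        simp only [List.length_cons, List.length_append] at hw ⊢
        omega
      have he := ih (u₁ ++ u₂) hlen (balanced_remove hbal)
      simp only [List.length_cons, List.length_append] at he ⊢
      rw [show u₁.length + (u₂.length + 1) + 1 = (u₁.length + u₂.length) + 2 by ring]
      exact he.add (by decide)

/-- The balanced words of length two are the backtracks `[a, a⁻¹]`. -/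
theorem eq_inv_of_balanced_two (a b : Letter) (h : balanced [a, b] = true) : b = a.inv := by
  revert a b h
  decide

/-- `Bool` form of `balanced_four`, checked by `decide` over the `8⁴` words of length four. -/
theorem balanced_four_bool : ∀ a b c d : Letter,
    (!(balanced [a, b, c, d] && !(b == a.inv) && !(c == b.inv) && !(d == c.inv)) ||
      (c == a.inv && d == b.inv && !(a.1 == b.1))) = true := by
  decide

/-- **Balanced words of length four**: either two consecutive letters are mutually inverse, or the
word is a plaquette word `[a, b, a⁻¹, b⁻¹]` with `a`, `b` in different directions. -/
theorem balanced_four (a b c d : Letter) (h : balanced [a, b, c, d] = true) :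
    (b = a.inv ∨ c = b.inv ∨ d = c.inv) ∨ (c = a.inv ∧ d = b.inv ∧ a.1 ≠ b.1) := by
  have key := balanced_four_bool a b c d
  rw [h] at key
  by_cases hb : b = a.inv
  · exact Or.inl (Or.inl hb)
  by_cases hc : c = b.inv
  · exact Or.inl (Or.inr (Or.inl hc))
  by_cases hd : d = c.inv
  · exact Or.inl (Or.inr (Or.inr hd))
  right
  have key' : (c = a.inv ∧ d = b.inv) ∧ ¬a.1 = b.1 := by simpa [hb, hc, hd] using key
  exact ⟨key'.1.1, key'.1.2, key'.2⟩

/-! ## Holonomies of the short balanced words -/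

/-- A backtrack has trivial holonomy. -/
theorem hol_two_inv (V : GaugeConfig 4 L G) (x : TorusSite 4 L) (a : Letter) :
    hol V x [a, a.inv] = 1 := by
  rw [show [a, a.inv] = a :: a.inv :: [] from rfl, hol_cons_inv_cons, hol_nil]

/-- **The canonical plaquette word** `[+μ̂, +ν̂, -μ̂, -ν̂]` has holonomy `plaquetteHolonomy V x μ ν`. -/
theorem hol_plaquetteWord (V : GaugeConfig 4 L G) (x : TorusSite 4 L) (μ ν : Fin 4) :
    hol V x [(μ, true), (ν, true), (μ, false), (ν, false)] = plaquetteHolonomy V x μ ν := by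
  simp only [hol_cons, hol_nil, mul_one, link, stepVec, plaquetteHolonomy,
    Literature.MathematicalPhysics.QuantumFieldTheory.Site.shift, Bool.false_eq_true, ↓reduceIte]
  try abel_nf
  try group

/-- The canonical plaquette word is closed. -/
theorem disp_plaquetteWord (μ ν : Fin 4) :
    disp [(μ, true), (ν, true), (μ, false), (ν, false)] = (0 : TorusSite 4 L) := by
  simp [disp, stepVec]

/-- The canonical plaquette word as a function `Fin 4 → Letter`. -/
theorem ofFn_plaquetteWord (μ ν : Fin 4) :
    List.ofFn ![(μ, true), (ν, true), (μ, false), (ν, false)] =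
      [(μ, true), (ν, true), (μ, false), (ν, false)] := by
  simp [List.ofFn_succ]

/-! ## Counting words -/

/-- There are `8 ^ k` words of length `k`. -/
theorem card_words (k : ℕ) : Fintype.card (Fin k → Letter) = 8 ^ k := by
  rw [Fintype.card_fun, Fintype.card_prod, Fintype.card_bool, Fintype.card_fin, Fintype.card_fin]

end Words

section Gamma

open Literature.Probability.LatticeModels Literature.MathematicalPhysics.QuantumLattice
  Literature.MathematicalPhysics.QuantumFieldTheory Matrix
open scoped ComplexConjugate

/-! ## Backtracks -/

/-- **Backtracks drop out**: `spinMat l * spinMat l⁻¹ = (1 ∓ γ_μ)(1 ± γ_μ) = 1 - γ_μ² = 0`. -/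
theorem spinMat_mul_spinMat_inv (l : Letter) : spinMat l * spinMat l.inv = 0 := by
  have h := euclideanGamma_mul_self l.1
  obtain ⟨μ, b⟩ := l
  cases b
  · simp only [spinMat, Letter.inv, Bool.not_false, Bool.false_eq_true, ↓reduceIte]
    rw [show (1 + euclideanGamma μ) * (1 - euclideanGamma μ) =
      1 - euclideanGamma μ * euclideanGamma μ by noncomm_ring, h, sub_self]
  · simp only [spinMat, Letter.inv, Bool.not_true, Bool.false_eq_true, ↓reduceIte]
    rw [show (1 - euclideanGamma μ) * (1 + euclideanGamma μ) =
      1 - euclideanGamma μ * euclideanGamma μ by noncomm_ring, h, sub_self]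

/-- A word with two consecutive mutually inverse letters has vanishing spin factor. -/
theorem spinWord_cons_cons_inv (u : List Letter) (l : Letter) (w : List Letter) :
    spinWord (u ++ l :: l.inv :: w) = 0 := by
  induction u with
  | nil => rw [List.nil_append, spinWord_cons, spinWord_cons, ← mul_assoc, spinMat_mul_spinMat_inv,
      zero_mul]
  | cons a u ih => rw [List.cons_append, spinWord_cons, ih, mul_zero]

/-! ## Reality of the spin traces -/

/-- Complex conjugation of the chiral-basis gamma matrices is conjugation by the real orthogonal
matrix `K = γ₀ γ₂`: `conj(γ_μ) K = K γ_μ`. -/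
theorem conj_euclideanGamma_mul_K (μ : Fin 4) :
    (euclideanGamma μ).map conj * !![0, -1, 0, 0; 1, 0, 0, 0; 0, 0, 0, -1; 0, 0, 1, 0] =
      !![0, -1, 0, 0; 1, 0, 0, 0; 0, 0, 0, -1; 0, 0, 1, 0] * euclideanGamma μ := by
  fin_cases μ <;>
    simp only [Fin.zero_eta, Fin.mk_one, Fin.reduceFinMk, euclideanGamma_zero, euclideanGamma_one,
      euclideanGamma_two, euclideanGamma_three] <;>
    ext i j <;> fin_cases i <;> fin_cases j <;>
      simp [Matrix.mul_apply, Fin.sum_univ_four, Matrix.map_apply]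

/-- The same intertwining for the spin factors `1 ∓ γ_μ`. -/
theorem conj_spinMat_mul_K (l : Letter) :
    (spinMat l).map conj * !![0, -1, 0, 0; 1, 0, 0, 0; 0, 0, 0, -1; 0, 0, 1, 0] =
      !![0, -1, 0, 0; 1, 0, 0, 0; 0, 0, 0, -1; 0, 0, 1, 0] * spinMat l := by
  have h1 : (1 : Matrix (Fin 4) (Fin 4) ℂ).map conj = 1 := by
    ext i j
    by_cases hij : i = j <;> simp [Matrix.one_apply, hij]
  obtain ⟨μ, b⟩ := l
  have h := conj_euclideanGamma_mul_K μ
  cases b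
  · simp only [spinMat, Bool.false_eq_true, ↓reduceIte]
    rw [Matrix.map_add _ (fun _ _ => map_add _ _ _), h1, add_mul, mul_add, one_mul, mul_one, h]
  · simp only [spinMat, ↓reduceIte]
    rw [Matrix.map_sub _ (fun _ _ => map_sub _ _ _), h1, sub_mul, mul_sub, one_mul, mul_one, h]

/-- And for the spin factor of a whole word. -/
theorem conj_spinWord_mul_K (w : List Letter) :
    (spinWord w).map conj * !![0, -1, 0, 0; 1, 0, 0, 0; 0, 0, 0, -1; 0, 0, 1, 0] =
      !![0, -1, 0, 0; 1, 0, 0, 0; 0, 0, 0, -1; 0, 0, 1, 0] * spinWord w := by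
  induction w with
  | nil =>
    have h1 : (1 : Matrix (Fin 4) (Fin 4) ℂ).map conj = 1 := by
      ext i j
      by_cases hij : i = j <;> simp [Matrix.one_apply, hij]
    rw [spinWord_nil, h1, one_mul, mul_one]
  | cons l w ih =>
    rw [spinWord_cons, Matrix.map_mul, mul_assoc, ih, ← mul_assoc, conj_spinMat_mul_K, mul_assoc]

/-- **The spin traces are real.** -/
theorem trace_spinWord_im (w : List Letter) : ((spinWord w).trace).im = 0 := by
  set K : Matrix (Fin 4) (Fin 4) ℂ := !![0, -1, 0, 0; 1, 0, 0, 0; 0, 0, 0, -1; 0, 0, 1, 0] with hK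
  have hKK : K * (-K) = 1 := by
    rw [hK]
    ext i j
    fin_cases i <;> fin_cases j <;> simp [Matrix.mul_apply, Fin.sum_univ_four]
  have h1 : ((spinWord w).map conj).trace = (spinWord w).trace := by
    calc ((spinWord w).map conj).trace = ((spinWord w).map conj * (K * -K)).trace := by
          rw [hKK, mul_one]
      _ = (K * spinWord w * -K).trace := by rw [← mul_assoc, conj_spinWord_mul_K]
      _ = (spinWord w).trace := by
          rw [Matrix.trace_mul_comm, ← mul_assoc, show -K * K = K * -K by rw [neg_mul, mul_neg], hKK,
            one_mul]
  have h2 : ((spinWord w).map conj).trace = conj ((spinWord w).trace) := by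
    simp [Matrix.trace, Matrix.map_apply, map_sum]
  rw [h2] at h1
  have h3 := congrArg Complex.im h1
  rw [Complex.conj_im] at h3
  linarith

/-! ## The size of the spin traces -/

/-- Row sums of a product: if the rows of `A` have `ℓ¹` norm `≤ a` and those of `B` have `≤ b`,
the rows of `A B` have `ℓ¹` norm `≤ a b`. -/
theorem rowsum_mul_le {A B : Matrix (Fin 4) (Fin 4) ℂ} {a b : ℝ} (hA : ∀ i, ∑ j, ‖A i j‖ ≤ a)
    (hB : ∀ i, ∑ j, ‖B i j‖ ≤ b) (i : Fin 4) : ∑ j, ‖(A * B) i j‖ ≤ a * b := by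
  have hb : 0 ≤ b := (Finset.sum_nonneg fun j _ => norm_nonneg (B 0 j)).trans (hB 0)
  calc ∑ j, ‖(A * B) i j‖ ≤ ∑ j, ∑ k, ‖A i k‖ * ‖B k j‖ := by
        refine Finset.sum_le_sum fun j _ => ?_
        rw [Matrix.mul_apply]
        exact (norm_sum_le _ _).trans (Finset.sum_le_sum fun k _ => (norm_mul_le _ _))
    _ = ∑ k, ‖A i k‖ * ∑ j, ‖B k j‖ := by
        rw [Finset.sum_comm]
        simp only [Finset.mul_sum]
    _ ≤ ∑ k, ‖A i k‖ * b :=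
        Finset.sum_le_sum fun k _ => mul_le_mul_of_nonneg_left (hB k) (norm_nonneg _)
    _ = (∑ k, ‖A i k‖) * b := by rw [Finset.sum_mul]
    _ ≤ a * b := mul_le_mul_of_nonneg_right (hA i) hb

/-- The rows of `1 ∓ γ_μ` have `ℓ¹` norm `≤ 2` (exactly two entries of modulus one). -/
theorem rowsum_spinMat_le (l : Letter) (i : Fin 4) : ∑ j, ‖spinMat l i j‖ ≤ 2 := by
  obtain ⟨μ, b⟩ := l
  fin_cases μ <;> cases b <;>
    simp only [spinMat, Bool.false_eq_true, ↓reduceIte, Fin.zero_eta, Fin.mk_one, Fin.reduceFinMk,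
      euclideanGamma_zero, euclideanGamma_one, euclideanGamma_two, euclideanGamma_three] <;>
    fin_cases i <;> simp [Fin.sum_univ_four, Matrix.one_apply] <;> norm_num

/-- The rows of `spinWord w` have `ℓ¹` norm `≤ 2^{|w|}`. -/
theorem rowsum_spinWord_le (w : List Letter) (i : Fin 4) : ∑ j, ‖spinWord w i j‖ ≤ 2 ^ w.length := by
  induction w generalizing i with
  | nil =>
    rw [spinWord_nil, List.length_nil, pow_zero]
    have : ∑ j, ‖(1 : Matrix (Fin 4) (Fin 4) ℂ) i j‖ = 1 := by
      rw [Finset.sum_eq_single i]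
      · simp
      · intro j _ hj; simp [Ne.symm hj]
      · simp
    rw [this]
  | cons l w ih =>
    rw [spinWord_cons, List.length_cons, pow_succ, mul_comm]
    exact rowsum_mul_le (rowsum_spinMat_le l) ih i

/-- **Size of the spin traces**: `‖tr (spinWord w)‖ ≤ 4 · 2^{|w|}`. -/
theorem norm_trace_spinWord_le (w : List Letter) : ‖(spinWord w).trace‖ ≤ 4 * 2 ^ w.length := by
  calc ‖(spinWord w).trace‖ ≤ ∑ i, ‖spinWord w i i‖ := norm_sum_le _ _
    _ ≤ ∑ i : Fin 4, ∑ j, ‖spinWord w i j‖ := by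
        refine Finset.sum_le_sum fun i _ => ?_
        have key : ∀ g : Fin 4 → ℝ, (∀ j, 0 ≤ g j) → g i ≤ ∑ j, g j :=
          fun g hg => Finset.single_le_sum (fun j _ => hg j) (Finset.mem_univ i)
        exact key (fun j => ‖spinWord w i j‖) fun j => norm_nonneg _
    _ ≤ ∑ _i : Fin 4, (2 : ℝ) ^ w.length := Finset.sum_le_sum fun i _ => rowsum_spinWord_le w i
    _ = 4 * 2 ^ w.length := by simp

/-! ## The plaquette traces -/

/-- **The plaquette spin trace**: for anticommuting traceless involutions `A`, `B` of `ℂ⁴`,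
`tr [(1 - A)(1 - B)(1 + A)(1 + B)] = -8`.  (Here `(1-B)(1+A) = (1+A)(1-B) + 2AB`, the first
term is killed by `(1-A)(1+A) = 0`, and `(1-A) A B (1+B) = AB + A - B - 1`.) -/
theorem trace_spinWord_plaquette_abstract (A B : Matrix (Fin 4) (Fin 4) ℂ) (hA : A * A = 1)
    (hB : B * B = 1) (hBA : B * A = -(A * B)) (htA : A.trace = 0) (htB : B.trace = 0) :
    ((1 - A) * (1 - B) * (1 + A) * (1 + B)).trace = -8 := by
  have hAB : (A * B).trace = 0 := by
    have h := Matrix.trace_mul_comm A B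
    rw [hBA, Matrix.trace_neg] at h
    linear_combination (1 / 2 : ℂ) * h
  have hA' : ∀ C : Matrix (Fin 4) (Fin 4) ℂ, A * (A * C) = C := fun C => by
    rw [← mul_assoc, hA, one_mul]
  have hB' : ∀ C : Matrix (Fin 4) (Fin 4) ℂ, B * (B * C) = C := fun C => by
    rw [← mul_assoc, hB, one_mul]
  have hBA' : ∀ C : Matrix (Fin 4) (Fin 4) ℂ, B * (A * C) = -(A * (B * C)) := fun C => by
    rw [← mul_assoc, hBA, neg_mul, mul_assoc]
  have key : (1 - A) * (1 - B) * (1 + A) * (1 + B) = 2 • (A * B) + 2 • A - 2 • B - 2 • 1 := by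
    simp only [mul_add, add_mul, mul_sub, sub_mul, one_mul, mul_one, mul_assoc, hA, hB, hA',
      hBA, mul_neg, neg_mul, sub_neg_eq_add]
    abel_nf
    try module
  rw [key, Matrix.trace_sub, Matrix.trace_sub, Matrix.trace_add, Matrix.trace_smul,
    Matrix.trace_smul, Matrix.trace_smul, Matrix.trace_smul, hAB, htA, htB, Matrix.trace_one,
    Fintype.card_fin]
  norm_num

/-- The gamma matrices are traceless. -/
theorem trace_euclideanGamma (μ : Fin 4) : (euclideanGamma μ).trace = 0 := by
  fin_cases μ <;>
    simp [euclideanGamma_zero, euclideanGamma_one, euclideanGamma_two, euclideanGamma_three,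
      Matrix.trace, Fin.sum_univ_four]

/-- The signed gamma matrix of a letter, `∓ γ_μ`, with `spinMat l = 1 - (signed gamma)` and
`spinMat l⁻¹ = 1 + (signed gamma)`; it is a traceless involution, and signed gammas of letters in
different directions anticommute. -/
theorem spinMat_eq_one_sub (l : Letter) :
    spinMat l = 1 - (if l.2 then euclideanGamma l.1 else -euclideanGamma l.1) ∧
      spinMat l.inv = 1 + (if l.2 then euclideanGamma l.1 else -euclideanGamma l.1) := by
  obtain ⟨μ, b⟩ := l
  cases b <;> simp [spinMat, Letter.inv, sub_eq_add_neg]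

/-- **The spin trace of a plaquette word is `-8`** (letters in different directions, any signs). -/
theorem trace_spinWord_plaquette (a b : Letter) (hab : a.1 ≠ b.1) :
    (spinWord [a, b, a.inv, b.inv]).trace = -8 := by
  set A : Matrix (Fin 4) (Fin 4) ℂ := if a.2 then euclideanGamma a.1 else -euclideanGamma a.1 with hAdef
  set B : Matrix (Fin 4) (Fin 4) ℂ := if b.2 then euclideanGamma b.1 else -euclideanGamma b.1 with hBdef
  obtain ⟨ha1, ha2⟩ := spinMat_eq_one_sub a
  obtain ⟨hb1, hb2⟩ := spinMat_eq_one_sub b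
  have hw : spinWord [a, b, a.inv, b.inv] = (1 - A) * (1 - B) * (1 + A) * (1 + B) := by
    rw [spinWord_cons, spinWord_cons, spinWord_cons, spinWord_cons, spinWord_nil, ha1, hb1, ha2, hb2,
      mul_one, ← mul_assoc, ← mul_assoc]
  have hA : A * A = 1 := by
    rw [hAdef]; split_ifs <;> simp [euclideanGamma_mul_self]
  have hB : B * B = 1 := by
    rw [hBdef]; split_ifs <;> simp [euclideanGamma_mul_self]
  have hBA : B * A = -(A * B) := by
    have h := euclideanGamma_mul_of_ne (Ne.symm hab)
    rw [hAdef, hBdef]; split_ifs <;> simp [h]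
  have htA : A.trace = 0 := by
    rw [hAdef]; split_ifs <;> simp [trace_euclideanGamma]
  have htB : B.trace = 0 := by
    rw [hBdef]; split_ifs <;> simp [trace_euclideanGamma]
  rw [hw]
  exact trace_spinWord_plaquette_abstract A B hA hB hBA htA htB

/-- **Balanced words of length four have nonpositive (real) spin trace**: `0` if two consecutive
letters are mutually inverse, `-8` for the plaquette words. -/
theorem re_trace_spinWord_four_le (a b c d : Letter) (h : balanced [a, b, c, d] = true) :
    ((spinWord [a, b, c, d]).trace).re ≤ 0 := by
  rcases balanced_four a b c d h with (h1 | h1 | h1) | ⟨h1, h2, h3⟩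
  · rw [h1, show [a, a.inv, c, d] = [] ++ a :: a.inv :: [c, d] from rfl, spinWord_cons_cons_inv]
    simp
  · rw [h1, show [a, b, b.inv, d] = [a] ++ b :: b.inv :: [d] from rfl, spinWord_cons_cons_inv]
    simp
  · rw [h1, show [a, b, c, c.inv] = [a, b] ++ c :: c.inv :: [] from rfl, spinWord_cons_cons_inv]
    simp
  · rw [h1, h2, trace_spinWord_plaquette a b h3]
    norm_num

end Gamma

end Summit.QuantumFields.QCD.Theorems.SmallHopping
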